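import Summits.FinalStateConjecture.FinalStateConjecture.Theorems.ClusterCompletenessRecurrentlyFlatDispersesStubAnchorCone
import Summits.FinalStateConjecture.FinalStateConjecture.Theorems.ClusterCompletenessRecurrentlyFlatDispersesStubChartFuture
import Summits.FinalStateConjecture.FinalStateConjecture.Theorems.ClusterCompletenessRecurrentlyFlatDispersesStubFutureSet
import Literature.Geometry.Lorentzian.CausalityClosure
import Literature.Geometry.Lorentzian.CausalityOpennessProofs
import Literature.Geometry.Lorentzian.CausalityPushUp
import Literature.Geometry.Manifold.InverseFunctionTheorem

/-!
# Crux `RecurrentlyFlatDisperses` (stmt-FinalStateConjecture-14665), line `Sketch` — the late slabs of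
# an anchored chart are CLOSED subsets of the development

Continuation lead c3, 2026-08-16. A geometric consequence of the crux's anchored-chart hypothesis,
recorded for refuters, auditors and future lines of this crux and of its siblings
`RecurrentMultiKerrCapture` / `OmegaLimitMultiKerr` (which posit the same anchored flat chart):
for every late chart time `τ > τ₀` the slab `S_τ = Ψ₀{x⁰ = τ}` is a CLOSED subset of `𝒟` (so,
being achronal by the landed `stub_futureSet` and a smooth spacelike hypersurface without edge, it is
a partial Cauchy surface: no complete-but-non-closed "spiralling" slab à la Harris, CQG 5 (1988),
can occur under the anchor).

Proof (`isClosed_image_timeSlab_of_chart`). Let `q ∈ closure S_τ`. Every point lies in the closure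
of its own chronological future (`mem_closure_chronologicalFuture_self`), so there is `q⁺ ∈ I⁺(q)`;
then `I⁻(q⁺)` is an open neighbourhood of `q` (`isOpen_chronologicalPast_of_boundaryless`), hence
meets `S_τ`, and `q⁺ ∈ I⁺(S_τ) ⊆ Ψ₀{x⁰ > τ}` (landed `stub_futureSet` (2)): `q⁺ = Ψ₀ z`, `z⁰ > τ`.
DISPLACEMENT BOUND (`FutureSet.norm_sub_le_of_curve`, from the landed cone estimate and lift,
`FutureSet.lift_cone` / `forall_mem_range` / `norm_sub_le_of_hasDerivAt`): a future timelike curve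
from `Ψ₀ y`, `y⁰ = τ`, to `Ψ₀ z` inside the chart image lifts to a coordinate curve with
`‖z − y‖ ≤ 2 (z⁰ − τ)`. Hence `S_τ ∩ I⁻(q⁺) ⊆ Ψ₀(K)` for the COMPACT set
`K = {y | y⁰ = τ, ‖y − z‖ ≤ 2 (z⁰ − τ)} ⊆ {x⁰ > τ₀}`, and `Ψ₀(K) ⊆ S_τ` is compact, so closed; as
`q ∈ closure (S_τ ∩ I⁻(q⁺)) ⊆ Ψ₀(K)`, `q ∈ S_τ`. ∎

* `FutureSet.norm_sub_le_of_curve` — the displacement bound for an injective local diffeomorphism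
  with the cone estimate (general chart form);
* `isClosed_image_timeSlab_of_chart` — the geometric statement for an anchored chart in a strongly
  causal spacetime with compact `J⁻(q) ∩ J⁺(S)`;
* `isClosed_image_timeSlab` — the crux-vocabulary form (hypotheses = the crux's anchored conjuncts,
  verbatim), side conditions discharged by the landed `stub_anchorCone`, `stub_chartFuture`,
  `stub_futureSet`.

Mathlib + the Literature cone + landed bricks of this line; no definitions, no named facts.
-/

noncomputable section

open scoped Manifold ContDiff Topology
open Bundle Filter Set Function TopologicalSpace Literature.Geometry.Lorentzian

namespace Summit.FinalStateConjecture.FinalStateConjecture.Theorems.RecurrentlyFlatDisperses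

namespace FutureSet

/-- **Displacement bound along a future timelike curve inside the chart image.** For `Φ : V → 𝓢`
(`V = {x⁰ > τ₀}`) an injective smooth local diffeomorphism with the cone estimate and open range in
`J⁺(S)` (all `J⁻(q) ∩ J⁺(S)` compact, `𝓢` strongly causal), a future timelike curve `γ` on `[a, b]`
with `γ a = Φ x₀` ends at a charted point `γ b = Φ x₁` with `‖x₁ − x₀‖ ≤ 2 (x₁⁰ − x₀⁰)`. -/
theorem norm_sub_le_of_curve {𝓢 : Spacetime 4} {V : Opens E4} [Nonempty V]
    {Φ : V → 𝓢.carrier} {τ₀ : ℝ} (hΦs : ContMDiff 𝓘(ℝ, E4) (𝓡 4) ∞ Φ) (hinj : Injective Φ)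
    (hloc : IsLocalDiffeomorph 𝓘(ℝ, E4) (𝓡 4) ∞ Φ)
    (hcone : ∀ (x : V) (w : E4), 𝓢.metric.IsTimelike (mfderiv 𝓘(ℝ, E4) (𝓡 4) Φ x w) →
      𝓢.timeOrientation.IsFutureDirected (mfderiv 𝓘(ℝ, E4) (𝓡 4) Φ x w) →
      0 < w 0 ∧ ‖w‖ < 2 * w 0)
    (hVmem : ∀ p : E4, p ∈ V ↔ τ₀ < p 0) (hWopen : IsOpen (range Φ))
    (hvert : ∀ x : V, 𝓢.metric.val (Φ x) (mfderiv 𝓘(ℝ, E4) (𝓡 4) Φ x (E4.basisVector 0))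
        (mfderiv 𝓘(ℝ, E4) (𝓡 4) Φ x (E4.basisVector 0)) ≤ -(3 / 4) ∧
      𝓢.timeOrientation.IsFutureDirected (mfderiv 𝓘(ℝ, E4) (𝓡 4) Φ x (E4.basisVector 0)))
    (hsc : 𝓢.metric.IsStronglyCausal 𝓢.timeOrientation) {S : Set 𝓢.carrier}
    (hK : ∀ q : 𝓢.carrier, IsCompact (𝓢.metric.causalPast 𝓢.timeOrientation {q} ∩
      𝓢.metric.causalFuture 𝓢.timeOrientation S))
    (hWS : range Φ ⊆ 𝓢.metric.causalFuture 𝓢.timeOrientation S)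
    {γ : ℝ → 𝓢.carrier} {a b : ℝ} (hab : a < b)
    (hγ : 𝓢.metric.IsFutureTimelikeCurveOn 𝓢.timeOrientation γ (Icc a b))
    (x₀ : V) (ha : γ a = Φ x₀) :
    ∃ x₁ : V, γ b = Φ x₁ ∧ ‖(x₁ : E4) - (x₀ : E4)‖ ≤ 2 * ((x₁ : E4) 0 - (x₀ : E4) 0) := by
  have hstay := forall_mem_range hΦs hinj hloc hcone hVmem hWopen hvert hsc hK hWS hγ ⟨x₀, ha.symm⟩
  set c : ℝ → E4 := fun t ↦ ((Function.invFun Φ (γ t) : V) : E4) with hc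
  have hder : ∀ t ∈ Icc a b, HasDerivAt c (deriv c t) t ∧ ‖deriv c t‖ ≤ 2 * deriv c t 0 :=
    fun t ht ↦ by
    obtain ⟨hd, -, h2⟩ := lift_cone hΦs hinj hloc hcone (hγ t ht) (hstay t ht)
    exact ⟨hd.hasDerivAt, h2.le⟩
  have hdisp : ‖c b - c a‖ ≤ 2 * (c b 0 - c a 0) :=
    norm_sub_le_of_hasDerivAt (w := fun t ↦ deriv c t) hab.le hder
  have h0 : Function.invFun Φ (γ a) = x₀ := by
    rw [ha]
    exact Function.leftInverse_invFun hinj x₀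
  have h2 : c a = (x₀ : E4) := by
    show ((Function.invFun Φ (γ a) : V) : E4) = (x₀ : E4)
    rw [h0]
  refine ⟨Function.invFun Φ (γ b), (Function.invFun_eq (hstay b ⟨hab.le, le_rfl⟩)).symm, ?_⟩
  rw [h2] at hdisp
  exact hdisp

end FutureSet

namespace SlabClosed

/-- **Closedness of the late slabs of an anchored chart (geometric form).** Let `Ψ₀ : U₀ → 𝓢` be a
smooth map on an open `U₀ ⊇ {x⁰ > τ₀}` of `E4` which is an open embedding on the late region
`{x⁰ > τ₀}`, anchored (`‖Ψ₀^* g − η‖ ≤ 1/4` pointwise on the late region) with `dΨ₀ ∂₀`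
future-directed there, whose late image lies in `J⁺(S)` for a set `S` with all `J⁻(q) ∩ J⁺(S)`
compact, in a strongly causal spacetime, and such that the chronological future of every late slab
lies in the chart above it. Then every late slab `Ψ₀{x⁰ = τ}`, `τ > τ₀`, is closed in `𝓢`. -/
theorem isClosed_image_timeSlab_of_chart {𝓢 : Spacetime 4}
    (hsc : 𝓢.metric.IsStronglyCausal 𝓢.timeOrientation) {S : Set 𝓢.carrier}
    (hK : ∀ q : 𝓢.carrier, IsCompact (𝓢.metric.causalPast 𝓢.timeOrientation {q} ∩
      𝓢.metric.causalFuture 𝓢.timeOrientation S))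
    {U₀ : Opens E4} {Ψ₀ : U₀ → 𝓢.carrier} {τ₀ : ℝ}
    (hΨs : ContMDiff 𝓘(ℝ, E4) (𝓡 4) ∞ Ψ₀)
    (hemb : Topology.IsOpenEmbedding (((Minkowski.backgroundOn U₀).lateRegion τ₀).restrict Ψ₀))
    (hU : {x : E4 | τ₀ < x 0} ⊆ (U₀ : Set E4))
    (hdev : ∀ y : U₀, τ₀ < y.1 0 → ‖𝓢.deviation (Minkowski.backgroundOn U₀) Ψ₀ y‖ ≤ 1 / 4)
    (hfut : ∀ y : U₀, τ₀ < y.1 0 →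
      𝓢.timeOrientation.IsFutureDirected (mfderiv 𝓘(ℝ, E4) (𝓡 4) Ψ₀ y (E4.basisVector 0)))
    (hWS : Ψ₀ '' (Minkowski.backgroundOn U₀).lateRegion τ₀ ⊆
      𝓢.metric.causalFuture 𝓢.timeOrientation S)
    (hslabF : ∀ τ : ℝ, τ₀ < τ →
      𝓢.metric.chronologicalFuture 𝓢.timeOrientation
          (Ψ₀ '' (Minkowski.backgroundOn U₀).timeSlab τ) ⊆
        Ψ₀ '' (Minkowski.backgroundOn U₀).lateRegion τ)
    {τ : ℝ} (hτ : τ₀ < τ) :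
    IsClosed (Ψ₀ '' (Minkowski.backgroundOn U₀).timeSlab τ) := by
  -- the late half-space `V` and the chart `Φ = Ψ₀|V` (as in the landed `stub_futureSet`)
  obtain ⟨V, hVmem⟩ : ∃ V : Opens E4, ∀ p : E4, p ∈ V ↔ τ₀ < p 0 :=
    ⟨⟨{x : E4 | τ₀ < x 0}, isOpen_lt continuous_const (PiLp.continuous_apply 2 _ 0)⟩,
      fun _ ↦ Iff.rfl⟩
  have hVU : V ≤ U₀ := fun p hp ↦ hU ((hVmem p).1 hp)
  haveI : Nonempty V :=
    ⟨⟨(τ₀ + 1) • (E4.basisVector 0 : E4), (hVmem _).2 (by simp [E4.basisVector])⟩⟩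
  have hlate : ∀ x : V, τ₀ < (Opens.inclusion hVU x).1 0 := fun x ↦ (hVmem x.1).1 x.2
  set Φ : V → 𝓢.carrier := Ψ₀ ∘ Opens.inclusion hVU with hΦdef
  have hΦs : ContMDiff 𝓘(ℝ, E4) (𝓡 4) ∞ Φ := hΨs.comp (contMDiff_inclusion hVU)
  have hdΦ : ∀ x : V, mfderiv 𝓘(ℝ, E4) (𝓡 4) Φ x =
      mfderiv 𝓘(ℝ, E4) (𝓡 4) Ψ₀ (Opens.inclusion hVU x) := fun x ↦
    FutureSet.mfderiv_comp_inclusion hVU x (hΨs.mdifferentiableAt (by simp))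
  have hrange : range Φ = Ψ₀ '' (Minkowski.backgroundOn U₀).lateRegion τ₀ :=
    FutureSet.range_comp_inclusion hVU Ψ₀ hVmem
  have hWopen : IsOpen (range Φ) := by
    rw [hrange, ← Set.range_restrict]
    exact hemb.isOpen_range
  have hinj : Injective Φ := by
    intro x₁ x₂ h
    have h' : (⟨Opens.inclusion hVU x₁, hlate x₁⟩ :
        (Minkowski.backgroundOn U₀).lateRegion τ₀) = ⟨Opens.inclusion hVU x₂, hlate x₂⟩ :=
      hemb.injective h
    exact Subtype.ext (congrArg (fun y : (Minkowski.backgroundOn U₀).lateRegion τ₀ ↦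
      (y.1 : E4)) h')
  have hloc : IsLocalDiffeomorph 𝓘(ℝ, E4) (𝓡 4) ∞ Φ := fun x ↦ by
    have hinjd : Injective (mfderiv 𝓘(ℝ, E4) (𝓡 4) Φ x) := by
      rw [hdΦ x]
      exact FutureSet.mfderiv_injective_of_deviation Ψ₀ _ (hdev _ (hlate x))
    set A : E4 →L[ℝ] E4 := mfderiv 𝓘(ℝ, E4) (𝓡 4) Φ x with hA
    have hinjA : Injective (A : E4 →ₗ[ℝ] E4) := hinjd
    have hbij : Bijective (A : E4 →ₗ[ℝ] E4) :=
      ⟨hinjA, LinearMap.injective_iff_surjective.1 hinjA⟩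
    set e : E4 ≃L[ℝ] E4 := (LinearEquiv.ofBijective (A : E4 →ₗ[ℝ] E4) hbij).toContinuousLinearEquiv
      with he
    exact Literature.Geometry.Manifold.isLocalDiffeomorphAt_of_mfderiv (by simp) isOpen_univ
      (mem_univ x) hΦs.contMDiffOn e (by ext v; rfl)
  have hcone : ∀ (x : V) (w : E4), 𝓢.metric.IsTimelike (mfderiv 𝓘(ℝ, E4) (𝓡 4) Φ x w) →
      𝓢.timeOrientation.IsFutureDirected (mfderiv 𝓘(ℝ, E4) (𝓡 4) Φ x w) →
      0 < w 0 ∧ ‖w‖ < 2 * w 0 := by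
    intro x w ht hf
    rw [hdΦ x] at ht hf
    exact FutureSet.cone_of_deviation Ψ₀ (Opens.inclusion hVU x) (hdev _ (hlate x))
      (hfut _ (hlate x)) w ht hf
  have hvert : ∀ x : V, 𝓢.metric.val (Φ x) (mfderiv 𝓘(ℝ, E4) (𝓡 4) Φ x (E4.basisVector 0))
        (mfderiv 𝓘(ℝ, E4) (𝓡 4) Φ x (E4.basisVector 0)) ≤ -(3 / 4) ∧
      𝓢.timeOrientation.IsFutureDirected (mfderiv 𝓘(ℝ, E4) (𝓡 4) Φ x (E4.basisVector 0)) := by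
    intro x
    rw [hdΦ x]
    exact ⟨FutureSet.val_mfderiv_basisVector_zero_le Ψ₀ _ (hdev _ (hlate x)), hfut _ (hlate x)⟩
  have hWS' : range Φ ⊆ 𝓢.metric.causalFuture 𝓢.timeOrientation S := hrange ▸ hWS
  -- the slab and a point of its closure
  set Sτ : Set 𝓢.carrier := Ψ₀ '' (Minkowski.backgroundOn U₀).timeSlab τ with hSτ
  refine isClosed_of_closure_subset fun q hq ↦ ?_
  -- a point `q⁺` of the chronological future of `q`
  have hne : (𝓢.metric.chronologicalFuture 𝓢.timeOrientation {q}).Nonempty := by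
    by_contra h
    rw [Set.not_nonempty_iff_eq_empty] at h
    have h1 := 𝓢.metric.mem_closure_chronologicalFuture_self 𝓢.timeOrientation (p := q)
      BoundarylessManifold.isInteriorPoint
    rw [h, closure_empty] at h1
    exact h1
  obtain ⟨q', hq'⟩ := hne
  -- `I⁻(q⁺)` is an open neighbourhood of `q`, hence meets the slab
  have hqpast : q ∈ 𝓢.metric.chronologicalPast 𝓢.timeOrientation {q'} :=
    LorentzianMetric.mem_chronologicalPast_of_mem_chronologicalFuture hq'
  have hopen : IsOpen (𝓢.metric.chronologicalPast 𝓢.timeOrientation {q'}) :=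
    LorentzianMetric.isOpen_chronologicalPast_of_boundaryless _ _ _
  obtain ⟨p₀, hp₀I, hp₀S⟩ := mem_closure_iff_nhds.mp hq _ (hopen.mem_nhds hqpast)
  -- so `q⁺` lies in the chart above `τ`
  have hq'S : q' ∈ 𝓢.metric.chronologicalFuture 𝓢.timeOrientation Sτ := by
    obtain ⟨_, hx, γ, a, b, hab, hγ, hγa, hγb⟩ :=
      LorentzianMetric.mem_chronologicalFuture_of_mem_chronologicalPast hp₀I
    rw [mem_singleton_iff] at hx
    exact ⟨p₀, hp₀S, γ, a, b, hab, hγ, hγa.trans hx, hγb⟩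
  obtain ⟨z, hzτ, hzq⟩ := hslabF τ hτ hq'S
  have hzτ' : τ < (z : E4) 0 := hzτ
  have hzV : (z : E4) ∈ V := (hVmem _).2 (hτ.trans hzτ')
  set zV : V := ⟨(z : E4), hzV⟩ with hzVdef
  have hΦz : Φ zV = q' := (congrArg Ψ₀ (Subtype.ext rfl)).trans hzq
  -- the compact piece of the slab that can see `q⁺`
  set R : ℝ := 2 * ((z : E4) 0 - τ) with hR
  set K : Set E4 := {w : E4 | w 0 = τ ∧ ‖w - (z : E4)‖ ≤ R} with hKdef
  have hK1 : K = (fun w : E4 ↦ w 0) ⁻¹' {τ} ∩ Metric.closedBall (z : E4) R := by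
    ext w
    simp only [hKdef, mem_setOf_eq, mem_inter_iff, mem_preimage, mem_singleton_iff,
      Metric.mem_closedBall, dist_eq_norm]
  have hKclosed : IsClosed K := by
    rw [hK1]
    exact ((isClosed_singleton.preimage (PiLp.continuous_apply 2 _ 0)).inter
      Metric.isClosed_closedBall)
  have hKcpt : IsCompact K :=
    (isCompact_closedBall (z : E4) R).of_isClosed_subset hKclosed
      (by rw [hK1]; exact inter_subset_right)
  have hKU : K ⊆ (U₀ : Set E4) := fun w hw ↦ hU (show τ₀ < w 0 by rw [hw.1]; exact hτ)
  set K' : Set U₀ := Subtype.val ⁻¹' K with hK'def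
  have hK'img : Subtype.val '' K' = K := by
    ext w
    constructor
    · rintro ⟨y, hy, rfl⟩
      exact hy
    · intro hw
      exact ⟨⟨w, hKU hw⟩, hw, rfl⟩
  have hK'cpt : IsCompact K' :=
    Topology.IsEmbedding.subtypeVal.isCompact_iff.mpr (hK'img ▸ hKcpt)
  set C : Set 𝓢.carrier := Ψ₀ '' K' with hCdef
  have hCclosed : IsClosed C := (hK'cpt.image hΨs.continuous).isClosed
  have hCS : C ⊆ Sτ := by
    rintro _ ⟨y, hy, rfl⟩
    exact ⟨y, hy.1, rfl⟩
  -- every point of the slab that can see `q⁺` is charted from `K`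
  have hclaim : 𝓢.metric.chronologicalPast 𝓢.timeOrientation {q'} ∩ Sτ ⊆ C := by
    rintro p ⟨hpI, hpS⟩
    obtain ⟨y, hyτ, rfl⟩ := hpS
    have hyτ' : (y : E4) 0 = τ := hyτ
    have hyV : (y : E4) ∈ V := (hVmem _).2 (by rw [hyτ']; exact hτ)
    set yV : V := ⟨(y : E4), hyV⟩ with hyVdef
    have hΦy : Φ yV = Ψ₀ y := congrArg Ψ₀ (Subtype.ext rfl)
    obtain ⟨x', hx', γ, a, b, hab, hγ, hγa, hγb⟩ :=
      LorentzianMetric.mem_chronologicalFuture_of_mem_chronologicalPast hpI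
    rw [mem_singleton_iff] at hx'
    obtain ⟨x₁, hx₁, hdisp⟩ := FutureSet.norm_sub_le_of_curve hΦs hinj hloc hcone hVmem hWopen
      hvert hsc hK hWS' hab hγ yV (hγa.trans (hx'.trans hΦy.symm))
    have hx₁z : x₁ = zV := hinj (hx₁.symm.trans (hγb.trans hΦz.symm))
    rw [hx₁z] at hdisp
    have hdisp' : ‖(y : E4) - (z : E4)‖ ≤ R := by
      rw [norm_sub_rev]
      have : ((zV : V) : E4) = (z : E4) := rfl
      rw [this, hyτ'] at hdisp
      exact hdisp
    exact ⟨y, show (y : E4) ∈ K from ⟨hyτ', hdisp'⟩, rfl⟩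
  -- conclusion: `q ∈ closure (I⁻(q⁺) ∩ S_τ) ⊆ C ⊆ S_τ`
  have hq1 : q ∈ closure (𝓢.metric.chronologicalPast 𝓢.timeOrientation {q'} ∩ Sτ) :=
    hopen.inter_closure ⟨hqpast, hq⟩
  have hq2 : q ∈ C := by
    rw [← hCclosed.closure_eq]
    exact closure_mono hclaim hq1
  exact hCS hq2

end SlabClosed

/-! ### The crux-vocabulary form -/

/-- **The late slabs of the crux's anchored flat chart are closed in the development.** In a maximal
vacuum Cauchy development of admissible data, for an anchored flat late chart of the crux's shape
(hypotheses = the five anchored-chart conjuncts of `Theses.ClusterCompleteness.RecurrentlyFlatDisperses`,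
verbatim) every late slab `Ψ₀ '' timeSlab τ`, `τ > τ₀`, is a closed subset of `𝒟`; the side conditions
of `SlabClosed.isClosed_image_timeSlab_of_chart` are the landed `stub_anchorCone`, `stub_chartFuture`,
`stub_futureSet` and the global hyperbolicity of the development (`CauchyDevelopment.isStronglyCausal`,
`isCompact_causalPast_inter_causalFuture_range`). -/
theorem isClosed_image_timeSlab :
    ∀ (X : Type) [TopologicalSpace X] [ChartedSpace E3 X] [IsManifold (𝓡 3) ∞ X] [T2Space X]
      [SecondCountableTopology X] [ConnectedSpace X],
      ∀ D ∈ admissibleVacuumData X, ∀ 𝒟 : VacuumCauchyDevelopment D, 𝒟.IsMaximal →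
        ∀ (O : Set 𝒟.carrier) (τ₀ : ℝ) (U₀ : Opens E4) (Ψ₀ : U₀ → 𝒟.carrier),
          (𝒟.toSpacetime.IsLateChart (Minkowski.backgroundOn U₀) O τ₀ Ψ₀ ∧
            {x : E4 | τ₀ < x 0} ⊆ (U₀ : Set E4) ∧
            O = Summit.FinalStateConjecture.exteriorOf 𝒟.toCauchyDevelopment
              (Ψ₀ '' (Minkowski.backgroundOn U₀).lateRegion τ₀) ∧
            (∀ τ₁ : ℝ, τ₀ < τ₁ → O \ Ψ₀ '' (Minkowski.backgroundOn U₀).lateRegion τ₁ ⊆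
              𝒟.metric.causalPast 𝒟.timeOrientation
                (Ψ₀ '' (Minkowski.backgroundOn U₀).timeSlab τ₁)) ∧
            (∀ τ : ℝ, τ₀ < τ → 𝒟.toSpacetime.deviationCk (Minkowski.backgroundOn U₀) Ψ₀ 0 τ ≤
              ENNReal.ofReal (1 / 4))) →
          ∀ τ : ℝ, τ₀ < τ → IsClosed (Ψ₀ '' (Minkowski.backgroundOn U₀).timeSlab τ) := by
  intro X _ _ _ _ _ _ D hD 𝒟 hmax O τ₀ U₀ Ψ₀ hyp τ hτ
  have hA := stub_anchorCone
  have hT := stub_chartFuture hA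
  have hF := stub_futureSet hA hT
  have hdev : ∀ y : U₀, τ₀ < y.1 0 →
      ‖𝒟.toSpacetime.deviation (Minkowski.backgroundOn U₀) Ψ₀ y‖ ≤ 1 / 4 :=
    hA X D hD 𝒟 hmax O τ₀ U₀ Ψ₀ hyp
  have hfut : ∀ y : U₀, τ₀ < y.1 0 →
      𝒟.timeOrientation.IsFutureDirected (mfderiv 𝓘(ℝ, E4) (𝓡 4) Ψ₀ y (E4.basisVector 0)) :=
    hT X D hD 𝒟 hmax O τ₀ U₀ Ψ₀ hyp
  have hslabF := (hF X D hD 𝒟 hmax O τ₀ U₀ Ψ₀ hyp).2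
  obtain ⟨hchart, hU, hO, -, -⟩ := hyp
  have hWS : Ψ₀ '' (Minkowski.backgroundOn U₀).lateRegion τ₀ ⊆
      𝒟.metric.causalFuture 𝒟.timeOrientation (range 𝒟.embed) := by
    intro q hq
    have h2 : q ∈ O := hchart.image_subset hq
    rw [hO] at h2
    exact h2.1
  exact SlabClosed.isClosed_image_timeSlab_of_chart (𝓢 := 𝒟.toSpacetime)
    𝒟.toCauchyDevelopment.isStronglyCausal
    𝒟.toCauchyDevelopment.isCompact_causalPast_inter_causalFuture_range hchart.contMDiff
    hchart.isOpenEmbedding hU hdev hfut hWS hslabF hτ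

end Summit.FinalStateConjecture.FinalStateConjecture.Theorems.RecurrentlyFlatDisperses

end
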